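import Literature.AnabelianGeometry.SemiGraphs.TemperedCompletionOpenSubgroups
import Literature.AnabelianGeometry.SemiGraphs.TemperedDeltaCompletion
import Literature.AnabelianGeometry.EtaleTheta.Discharge.Sec2DeltaXuuIndex

/-!
# Indices survive profinite completion: `[F̂ : Ū] = [F : U]` for open subgroups of finite index, and the
# PROFINITE degrees `[Δ_X : Δ̂_X̲] = l`, `[Δ̂_X̲ : Δ̂_X̲̲] = l` of the [EtTh] §2 coverings in the §1 model

Mochizuki, *Semi-graphs of anabelioids* [SemiAnbd], Publ. RIMS **42** (2006), §6 p. 69 ("we shall denote the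
profinite completion of a group by means of a `∧`"; p. 73 "the `∧` denotes profinite completion, or, equivalently,
closure in `Π_{X_K}`") [cite: MochizukiSemiAnbd2006, §6 p.69]; Mochizuki, *The étale theta function …* [EtTh],
Publ. RIMS **45** (2009), §2, Prop. 2.2 (ii) PRIMS PDF p. 37 ("`Δ̄_X̲ = Δ̄_X̲̲ · Δ̄_Θ`", `Δ̄_X̲̲` cyclic of order `l` —
the PROFINITE `Δ_X̲̲ ⊆ Δ_X̲` has index `l`), Rmk. 2.3.1 p. 38 ("extracting two copies of `ℤ/lℤ`")
[cite: MochizukiEtTh2009, Prop 2.2 (ii) p.37]. PROOF-ONLY (0 definitions; cell abc-iut, layer L2, seat abc-iut-L2-t8 —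
the `X̲̲`-adapter owner; written for the completion transport named «remaining» by abc-iut-L6-t19's B14 prelims and
abc-iut-L2-d3's W3-L2-02 phase 2).

* GENERIC, over abc-iut-L3's interface `SemiGraphs.IsProfiniteCompletion ι` (`ι : F → F̂` a profinite completion of a
  topological group: compact Hausdorff totally disconnected target, dense range, open normal finite-index subgroups
  pulled back from `F̂`): for an OPEN subgroup `U ≤ F` of FINITE INDEX, with `Ū :=` the closure of `ι(U)` in `F̂`
  (open, and `ι⁻¹(Ū) = U`: abc-iut-w5-d139's `isOpen_topologicalClosure_map` / `comap_topologicalClosure_map`),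
  **`IsProfiniteCompletion.index_topologicalClosure_map : [F̂ : Ū] = [F : U]`** — the coset map `F/U → F̂/Ū` is
  injective because `ι⁻¹(Ū) = U` and surjective because every (open) coset `z·Ū` meets the dense image of `ι`;
  `finiteIndex_topologicalClosure_map`; and the relative form `relIndex_topologicalClosure_map` for `U ≤ U'` both open
  of finite index: `[Ū' : Ū] = [U' : U]`. (abc-iut-w5-d102's `IUT.HodgeTheaters.ProfiniteCompletion.index_topologicalClosure_map`
  is the same statement for Mathlib's completion of a DISCRETE group; the present one is for the topological interface.)
* AT THE [EtTh] §1 MODEL, along abc-iut-L3's `TemperedCurve.deltaToHat : Δ^tp_X → Δ_X` (a profinite completion under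
  the parameter bundle `d : GroupLevelData`, `isProfiniteCompletion_deltaToHat`): writing `Δ̂_X̲`, `Δ̂_X̲̲ ⊆ Δ_X` for the
  closures of (the images of) `Δ^tp_X̲ = Π^tp_X̲ ∩ Δ^tp_X` and `Δ^tp_X̲̲ = Π^tp_X̲̲ ∩ Δ^tp_X`, the tempered indices of
  `Discharge/Sec2DeltaXuuIndex.lean` (abc-iut-L2-t8, p421807) become **`[Δ_X : Δ̂_X̲] = l`** (`index_closure_deltaXu`),
  **`[Δ_X : Δ̂_X̲̲] = l²`** (`index_closure_deltaXuu`) and **`[Δ̂_X̲ : Δ̂_X̲̲] = l`** (`relIndex_closure_deltaXuu_deltaXu`).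

Honest framing: classical topological group theory + bookkeeping; the §1/§2 structures (`ThetaSetting`,
`EtaleThetaData.DoubleUnderline`, `GroupLevelData`) are data quoting print, asserted to exist for no curve here; no side
is taken on [IUTchIII] Cor. 3.12.
-/

noncomputable section

namespace Literature.AnabelianGeometry.SemiGraphs

namespace IsProfiniteCompletion

open Topology

universe u v

variable {F : Type u} {Fhat : Type v} [Group F] [TopologicalSpace F] [IsTopologicalGroup F]
  [Group Fhat] [TopologicalSpace Fhat] [IsTopologicalGroup Fhat] {ι : F →ₜ* Fhat}

/-- **Indices survive profinite completion**: for a profinite completion `ι : F → F̂` and an OPEN subgroup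
`U ≤ F` of FINITE INDEX, the closure `Ū` of `ι(U)` in `F̂` has `[F̂ : Ū] = [F : U]` ("the `∧` denotes profinite
completion, or, equivalently, closure", [SemiAnbd] p. 73): the coset map `F/U → F̂/Ū` is injective (`ι⁻¹(Ū) = U`)
and surjective (every open coset `z·Ū` meets the dense image of `ι`). [cite: MochizukiSemiAnbd2006, §6 p.69] -/
theorem index_topologicalClosure_map (hι : IsProfiniteCompletion ι) (U : Subgroup F)
    (hU : IsOpen (U : Set F)) [U.FiniteIndex] :
    ((U.map ι.toMonoidHom).topologicalClosure).index = U.index := by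
  set W : Subgroup Fhat := (U.map ι.toMonoidHom).topologicalClosure with hWdef
  have hcomap : W.comap ι.toMonoidHom = U := comap_topologicalClosure_map hι U hU
  have hWopen : IsOpen (W : Set Fhat) := isOpen_topologicalClosure_map hι U hU
  have hmem : ∀ a : F, ι a ∈ W ↔ a ∈ U := fun a => by
    rw [← hcomap, Subgroup.mem_comap]
    rfl
  -- the coset map `F/U → F̂/W`
  have hrel : ∀ a b : F, QuotientGroup.leftRel U a b → QuotientGroup.leftRel W (ι a) (ι b) := by
    intro a b h
    rw [QuotientGroup.leftRel_apply] at h ⊢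
    rw [← map_inv, ← map_mul]
    exact (hmem _).mpr h
  let φ : F ⧸ U → Fhat ⧸ W := Quotient.map' ι hrel
  have hφ : ∀ a : F, φ (QuotientGroup.mk a) = QuotientGroup.mk (ι a) := fun a => rfl
  have hinj : Function.Injective φ := by
    intro x y hxy
    induction x using QuotientGroup.induction_on with
    | H a =>
      induction y using QuotientGroup.induction_on with
      | H b =>
        rw [hφ, hφ, QuotientGroup.eq, ← map_inv, ← map_mul, hmem] at hxy
        exact QuotientGroup.eq.mpr hxy
  have hsurj : Function.Surjective φ := by
    intro y
    induction y using QuotientGroup.induction_on with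
    | H z =>
      have hopen : IsOpen ((fun w : Fhat => z * w) '' (W : Set Fhat)) :=
        (Homeomorph.mulLeft z).isOpenMap _ hWopen
      obtain ⟨f, w, hw, hzw⟩ :=
        hι.denseRange.exists_mem_open hopen ⟨z * 1, ⟨1, W.one_mem, rfl⟩⟩
      refine ⟨QuotientGroup.mk f, ?_⟩
      rw [hφ, QuotientGroup.eq, ← hzw, mul_inv_rev, inv_mul_cancel_right]
      exact W.inv_mem hw
  rw [Subgroup.index_eq_card, Subgroup.index_eq_card]
  exact (Nat.card_congr (Equiv.ofBijective φ ⟨hinj, hsurj⟩)).symm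

/-- Hence `Ū` has finite index in `F̂`. [cite: MochizukiSemiAnbd2006, §6 p.69] -/
theorem finiteIndex_topologicalClosure_map (hι : IsProfiniteCompletion ι) (U : Subgroup F)
    (hU : IsOpen (U : Set F)) [U.FiniteIndex] :
    ((U.map ι.toMonoidHom).topologicalClosure).FiniteIndex :=
  ⟨by rw [index_topologicalClosure_map hι U hU]; exact Subgroup.FiniteIndex.index_ne_zero⟩

/-- **Relative indices survive profinite completion**: for open subgroups `U ≤ U'` of finite index,
`[Ū' : Ū] = [U' : U]`. [cite: MochizukiSemiAnbd2006, §6 p.69] -/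
theorem relIndex_topologicalClosure_map (hι : IsProfiniteCompletion ι) (U U' : Subgroup F)
    (hU : IsOpen (U : Set F)) [U.FiniteIndex] (hU' : IsOpen (U' : Set F)) [U'.FiniteIndex] (hle : U ≤ U') :
    ((U.map ι.toMonoidHom).topologicalClosure).relIndex ((U'.map ι.toMonoidHom).topologicalClosure) =
      U.relIndex U' := by
  have hle' : (U.map ι.toMonoidHom).topologicalClosure ≤ (U'.map ι.toMonoidHom).topologicalClosure :=
    Subgroup.topologicalClosure_mono (Subgroup.map_mono hle)
  have h1 := Subgroup.relIndex_mul_index hle'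
  have h2 := Subgroup.relIndex_mul_index hle
  rw [index_topologicalClosure_map hι U hU, index_topologicalClosure_map hι U' hU', ← h2] at h1
  exact Nat.eq_of_mul_eq_mul_right (Nat.pos_of_ne_zero Subgroup.FiniteIndex.index_ne_zero) h1

end IsProfiniteCompletion

end Literature.AnabelianGeometry.SemiGraphs

namespace Literature.AnabelianGeometry.EtaleTheta

open Literature.AnabelianGeometry.SemiGraphs

namespace ThetaSetting

variable {p : ℕ} [Fact p.Prime] {D : ThetaSetting p} (l : ℕ)

/-! ## The profinite degrees of `X̲ → X` and `X̲̲ → X̲` on the geometric side -/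

/-- `Δ^tp_X̲`, read inside the subtype group `Δ^tp_X`, is OPEN (as `Π^tp_X̲` is open in `Π^tp_X`).
[cite: MochizukiEtTh2009, Def 2.5 (i) p.39] -/
theorem isOpen_GtpXu_subgroupOf_deltaTemp :
    IsOpen (((D.GtpXu l).subgroupOf D.DeltaTemp : Subgroup D.DeltaTemp) : Set D.DeltaTemp) :=
  (D.isOpen_GtpXu l).preimage continuous_subtype_val

/-- … and has index `l` in `Δ^tp_X` (`[Δ^tp_X : Δ^tp_X̲] = l`, `Discharge/Sec2DeltaXuuIndex.lean`).
[cite: MochizukiEtTh2009, Def 2.1 p.36] -/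
theorem index_GtpXu_subgroupOf_deltaTemp : ((D.GtpXu l).subgroupOf D.DeltaTemp).index = l := by
  rw [← Subgroup.inf_subgroupOf_right (D.GtpXu l) D.DeltaTemp]
  exact D.relIndex_deltaXu_deltaTemp l

/-- **`[Δ_X : Δ̂_X̲] = l`**: the closure in `Δ_X` (L3's `DeltaHat`, the profinite completion of `Δ^tp_X` under the
parameter bundle `d : GroupLevelData`, `isProfiniteCompletion_deltaToHat`) of the image of `Δ^tp_X̲ = Π^tp_X̲ ∩ Δ^tp_X`
has index `l` (`l ≠ 0`) — the PROFINITE form of "`Δ_X̲ ⊆ Δ_X`, `Gal(X̲/X) ≅ ℤ/lℤ`" (Def. 2.1, Rmk. 2.1.1).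
[cite: MochizukiEtTh2009, Rmk 2.1.1 p.36] -/
theorem index_closure_deltaXu (d : D.toTemperedCurve.GroupLevelData) (hl : l ≠ 0) :
    ((((D.GtpXu l).subgroupOf D.DeltaTemp).map D.toTemperedCurve.deltaToHat.toMonoidHom).topologicalClosure).index
      = l := by
  haveI : ((D.GtpXu l).subgroupOf D.DeltaTemp).FiniteIndex :=
    ⟨by rw [D.index_GtpXu_subgroupOf_deltaTemp l]; exact hl⟩
  rw [IsProfiniteCompletion.index_topologicalClosure_map (D.toTemperedCurve.isProfiniteCompletion_deltaToHat d)
    _ (D.isOpen_GtpXu_subgroupOf_deltaTemp l)]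
  exact D.index_GtpXu_subgroupOf_deltaTemp l

namespace EtaleThetaData.DoubleUnderline

variable {E : D.EtaleThetaData} {l} (C : E.DoubleUnderline l)

/-- `Δ^tp_X̲̲`, read inside `Δ^tp_X`, is OPEN (as `Π^tp_X̲̲` is open in `Π^tp_X`, field `isOpen_Huu`).
[cite: MochizukiEtTh2009, Def 2.5 (i) p.39] -/
theorem isOpen_Huu_subgroupOf_deltaTemp :
    IsOpen ((C.Huu.subgroupOf D.DeltaTemp : Subgroup D.DeltaTemp) : Set D.DeltaTemp) :=
  C.isOpen_Huu.preimage continuous_subtype_val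

/-- … and has index `l²` in `Δ^tp_X` (`[Δ^tp_X : Δ^tp_X̲̲] = l²`, `Discharge/Sec2DeltaXuuIndex.lean`).
[cite: MochizukiEtTh2009, Rmk 2.3.1 p.38] -/
theorem index_Huu_subgroupOf_deltaTemp : (C.Huu.subgroupOf D.DeltaTemp).index = l ^ 2 := by
  rw [← Subgroup.inf_subgroupOf_right C.Huu D.DeltaTemp]
  exact C.relIndex_deltaXuu_deltaTemp

/-- `Δ^tp_X̲̲ ≤ Δ^tp_X̲` inside `Δ^tp_X`. [cite: MochizukiEtTh2009, Def 2.5 (i) p.39] -/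
theorem Huu_subgroupOf_deltaTemp_le :
    C.Huu.subgroupOf D.DeltaTemp ≤ (D.GtpXu l).subgroupOf D.DeltaTemp :=
  fun _ hx => C.Huu_le_GtpXu hx

/-- **`[Δ_X : Δ̂_X̲̲] = l²`**: the closure in `Δ_X` of the image of `Δ^tp_X̲̲ = Π^tp_X̲̲ ∩ Δ^tp_X` has index `l²`
(PROFINITE form of "extracting two copies of `ℤ/lℤ`" on the geometric side, Rmk. 2.3.1), under the parameter
bundle `d : GroupLevelData` making `Δ^tp_X → Δ_X` a profinite completion. [cite: MochizukiEtTh2009, Rmk 2.3.1 p.38] -/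
theorem index_closure_deltaXuu (d : D.toTemperedCurve.GroupLevelData) :
    (((C.Huu.subgroupOf D.DeltaTemp).map D.toTemperedCurve.deltaToHat.toMonoidHom).topologicalClosure).index
      = l ^ 2 := by
  haveI : (C.Huu.subgroupOf D.DeltaTemp).FiniteIndex :=
    ⟨by rw [C.index_Huu_subgroupOf_deltaTemp]; exact pow_ne_zero 2 C.l_ne_zero⟩
  rw [IsProfiniteCompletion.index_topologicalClosure_map (D.toTemperedCurve.isProfiniteCompletion_deltaToHat d)
    _ C.isOpen_Huu_subgroupOf_deltaTemp]
  exact C.index_Huu_subgroupOf_deltaTemp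

/-- **`[Δ̂_X̲ : Δ̂_X̲̲] = l`** — the PROFINITE degree of `X̲̲ → X̲` on the geometric side ("the 'geometric portion'
`Δ_X̲̲` of `Π_X̲̲` maps isomorphically onto `Δ̄^ell_X̲` [hence is a cyclic group of order `l`] … `Δ̄_X̲ = Δ̄_X̲̲ · Δ̄_Θ`",
Prop. 2.2 (ii) p. 37): closures in `Δ_X` of `Δ^tp_X̲̲ ⊆ Δ^tp_X̲`, under the parameter bundle `d : GroupLevelData`;
the tempered index `[Δ^tp_X̲ : Δ^tp_X̲̲] = l` is `relIndex_deltaXuu_deltaXu`. [cite: MochizukiEtTh2009, Prop 2.2 (ii) p.37] -/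
theorem relIndex_closure_deltaXuu_deltaXu (d : D.toTemperedCurve.GroupLevelData) :
    (((C.Huu.subgroupOf D.DeltaTemp).map D.toTemperedCurve.deltaToHat.toMonoidHom).topologicalClosure).relIndex
        ((((D.GtpXu l).subgroupOf D.DeltaTemp).map D.toTemperedCurve.deltaToHat.toMonoidHom).topologicalClosure)
      = l := by
  haveI : (C.Huu.subgroupOf D.DeltaTemp).FiniteIndex :=
    ⟨by rw [C.index_Huu_subgroupOf_deltaTemp]; exact pow_ne_zero 2 C.l_ne_zero⟩
  haveI : ((D.GtpXu l).subgroupOf D.DeltaTemp).FiniteIndex :=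
    ⟨by rw [D.index_GtpXu_subgroupOf_deltaTemp l]; exact C.l_ne_zero⟩
  rw [IsProfiniteCompletion.relIndex_topologicalClosure_map (D.toTemperedCurve.isProfiniteCompletion_deltaToHat d)
    _ _ C.isOpen_Huu_subgroupOf_deltaTemp (D.isOpen_GtpXu_subgroupOf_deltaTemp l) C.Huu_subgroupOf_deltaTemp_le,
    ← Subgroup.inf_subgroupOf_right (D.GtpXu l) D.DeltaTemp,
    Subgroup.relIndex_subgroupOf (inf_le_right : D.GtpXu l ⊓ D.DeltaTemp ≤ D.DeltaTemp)]
  exact C.relIndex_Huu_deltaXu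

end EtaleThetaData.DoubleUnderline

end ThetaSetting

end Literature.AnabelianGeometry.EtaleTheta
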